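import Summits.BirchSwinnertonDyer.BirchSwinnertonDyer.Theorems.ManinLocalTwoThreeColumnRelationsOneHundredEight
import Summits.BirchSwinnertonDyer.BirchSwinnertonDyer.Theorems.ManinLocalTwoThreeCurveExclusionOneHundredEight
import Summits.BirchSwinnertonDyer.BirchSwinnertonDyer.Theorems.ManinLocalTwoThreeOldWitnessesOneHundredEight
import Summits.BirchSwinnertonDyer.BirchSwinnertonDyer.Theorems.ManinLocalTwoThreeNewformPinningFortyFourOfTable
import Literature.NumberTheory.EllipticCurves.CuspFormLFunctionLevelConductorProofs
import HarnessLib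

/-!
# Level `108 = 2²·3³` (both crux domains, genus 10): THE NEWFORM OF EVERY `X₀(108)`-DATUM IS `φ₁₀₈ = −2B₁ + 2B₂ + B₃ + 6B₄ + 6B₅`, FACT-FREE

Cell `bsd-f2-manin`, route `ManinLocalTwoThree`, cruxes C2 `ManinOddAtFour` (stmt-BirchSwinnertonDyer-22967) and C3 `ManinPrimeToThreeAtNine`
(stmt-BirchSwinnertonDyer-22968), prover seat p1 gen 25; `--supports stmt-BirchSwinnertonDyer-22967` (helper).  The assembly of the
level-`108` newform pinning (an g51 MEMO-an §96 «pinning by the curve's own recursion», `S₂`-variant; groundwork p1 g24: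
`…EtaCuspBasisOneHundredEight`, `…BasisSolveOneHundredEight`, `…OldWitnessesOneHundredEight`; p1 g25: `…ColumnRelationsOneHundredEight`,
`…CurveExclusionOneHundredEight`).  For every elliptic `W/ℚ` and every `D : ModularParametrizationData W 108`:

* `curveInputs_oneHundredEight` : `a₂(W) = a₃(W) = 0` (newness at `4 ∣ 108`, `9 ∣ 108`: tree `cuspCoeff_eq_zero_of_sq_dvd_of_mem_newSubspace0`),
  `2 ∣ N_W`, `3 ∣ N_W` (tree `IsNewformOf.dvd_level_iff_dvd_conductorNorm`), hence the dead pivots `a₄ = a₈ = a₁₀ = 0`;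
* `coeffs_cases_oneHundredEight` : the four column relations of `S₂(Γ₀(108))` read on `D.f` feed `coeffVector_oneHundredEight`:
  `(a₅, a₇, a₁₃, a₁₉)` is `108a`'s `(0, 5, −7, −1)` or one of eight OLD vectors;
* `coeffs_eq_oneHundredEightA` : the eight old vectors are killed by `old ⊓ new = ⊥` (`LevelFortyFour.not_mem_oldSubspace0_of_isNewform0`)
  and the landed explicit old witnesses `oldWitness108_3 … oldWitness108_10` with the same TEN pivot coefficients (`pivotsSeparate_oneHundredEight`);
* **`f_eq_phi108`** : `D.f = Σᵢ φᵢ • Bᵢc` with `φ = (−2, 2, 1, 6, 6, 0, 0, 0, 0, 0)`, and **`f_apply_eq_phi108`** : `⇑D.f` is LITERALLY the function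
  `τ ↦ −2·η-quotient₁(τ) + 2·η-quotient₂(τ) + η-quotient₃(τ) + 6·η-quotient₄(τ) + 6·η-quotient₅(τ)` that p3 g24's
  `NeronSqueezeOneHundredEight.maninConstant_oneHundredEight_of_pinning` takes as its hypothesis `hpin` — discharging it.

No newness, eigenform or cuspidality statement about `φ₁₀₈` is proved; it inherits them from `D.f`.  HONEST FRAMING: unconditional (standard
axioms); with p3's squeeze this makes `|c| = 1`, `2 ∤ c`, `3 ∤ c` on `X₀(108)` fact-free (sequel `…ManinConstantOneHundredEight`).  Nothing here
proves the `∀ N` cruxes C2/C3, Manin's conjecture or BSD.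
[cite: AtkinLehner1970, Thm. 3, Thm. 5] [cite: DiamondShurman2005, §5.8, §8.8 (8.44)] [cite: CremonaAlgorithms1997, Table 3 (N = 108)]
-/

set_option autoImplicit false
-- lint-debt: the directory name repeats the summit name (sibling precedent `ManinLocalTwoThreeNewformPinningFortyFour.lean`)
set_option linter.dupNamespace false

noncomputable section

open Complex
open UpperHalfPlane hiding I
open scoped MatrixGroups ModularForm
open CongruenceSubgroup PowerSeries
open Literature.NumberTheory.ModularForms
open Literature.NumberTheory.EllipticCurves Literature.NumberTheory.EllipticCurves.ModularForms

namespace Summit.BirchSwinnertonDyer.BirchSwinnertonDyer.Theorems.ManinLocalTwoThree.LevelOneHundredEight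

variable {W : WeierstrassCurve ℚ} [W.IsElliptic]

/-! ## §1 The curve side of an `X₀(108)`-datum -/

omit [W.IsElliptic] in
/-- The coefficients of `D.f` are the curve's `aₙ`. [folklore] -/
theorem cuspCoeff_f108 (D : ModularParametrizationData W 108) (n : ℕ) : cuspCoeff D.f n = (W.LFunction n : ℂ) :=
  D.isNewformOf.2 n

/-- **Curve-side inputs at `108`**: `a₂(W) = 0`, `a₃(W) = 0` (newness, `2² ∣ 108`, `3² ∣ 108`), `2 ∣ N_W`, `3 ∣ N_W`.
[cite: AtkinLehner1970, Thm. 3] [cite: DiamondShurman2005, §5.8, (8.44)] -/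
theorem curveInputs_oneHundredEight (D : ModularParametrizationData W 108) :
    W.LFunction 2 = 0 ∧ W.LFunction 3 = 0 ∧ 2 ∣ W.conductorNorm ℤ ∧ 3 ∣ W.conductorNorm ℤ := by
  refine ⟨?_, ?_, (D.isNewformOf.dvd_level_iff_dvd_conductorNorm Nat.prime_two).mp ⟨54, by norm_num⟩,
    (D.isNewformOf.dvd_level_iff_dvd_conductorNorm Nat.prime_three).mp ⟨36, by norm_num⟩⟩
  · have h0 := cuspCoeff_eq_zero_of_sq_dvd_of_mem_newSubspace0 D.isNewformOf.1.1 Nat.prime_two ⟨27, by norm_num⟩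
    rw [D.isNewformOf.2 2] at h0
    exact_mod_cast h0
  · have h0 := cuspCoeff_eq_zero_of_sq_dvd_of_mem_newSubspace0 D.isNewformOf.1.1 Nat.prime_three ⟨12, by norm_num⟩
    rw [D.isNewformOf.2 3] at h0
    exact_mod_cast h0

/-- **The dead pivots**: `a₄(W) = a₈(W) = a₁₀(W) = 0` (`a₂ = 0`, `2 ∣ N_W`, multiplicativity). [cite: DiamondShurman2005, §8.8 (8.44)] -/
theorem deadPivots_oneHundredEight (D : ModularParametrizationData W 108) :
    W.LFunction 4 = 0 ∧ W.LFunction 8 = 0 ∧ W.LFunction 10 = 0 := by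
  obtain ⟨h2, -, h2N, -⟩ := curveInputs_oneHundredEight D
  have r4 := LevelFortyFour.lFunction_four W
  have r8 := LevelFortyFour.lFunction_eight W
  have m10 : W.LFunction 10 = W.LFunction 2 * W.LFunction 5 := LevelFortyFour.lFunction_mul W (m := 2) (n := 5) (by norm_num)
  rw [if_pos h2N] at r4 r8
  refine ⟨by rw [r4, h2]; ring, by rw [r8, h2]; ring, by rw [m10, h2]; ring⟩

/-! ## §2 The nine cases and the exclusion of the eight old ones -/

/-- **The nine cases** for `(a₅, a₇, a₁₃, a₁₉)(W)`: the column relations of `S₂(Γ₀(108))` on `D.f` + the curve-side exclusion.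
[cite: DiamondShurman2005, §8.8 (8.44)] [cite: CremonaAlgorithms1997, Table 3 (N = 108)] -/
theorem coeffs_cases_oneHundredEight (D : ModularParametrizationData W 108) :
    (W.LFunction 5 = 0 ∧ W.LFunction 7 = 5 ∧ W.LFunction 13 = -7 ∧ W.LFunction 19 = -1) ∨
      (W.LFunction 5 = 0 ∧ W.LFunction 7 = -1 ∧ W.LFunction 13 = 5 ∧ W.LFunction 19 = -7) ∨
      (W.LFunction 5 = 0 ∧ W.LFunction 7 = -4 ∧ W.LFunction 13 = 2 ∧ W.LFunction 19 = 8) ∨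
      (W.LFunction 5 = 1 ∧ W.LFunction 7 = -1 ∧ W.LFunction 13 = 4 ∧ W.LFunction 19 = -6) ∨
      (W.LFunction 5 = -1 ∧ W.LFunction 7 = -1 ∧ W.LFunction 13 = 4 ∧ W.LFunction 19 = -6) ∨
      (W.LFunction 5 = 2 ∧ W.LFunction 7 = -1 ∧ W.LFunction 13 = 1 ∧ W.LFunction 19 = -3) ∨
      (W.LFunction 5 = -2 ∧ W.LFunction 7 = -1 ∧ W.LFunction 13 = 1 ∧ W.LFunction 19 = -3) ∨
      (W.LFunction 5 = 3 ∧ W.LFunction 7 = -1 ∧ W.LFunction 13 = -4 ∧ W.LFunction 19 = 2) ∨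
      (W.LFunction 5 = -3 ∧ W.LFunction 7 = -1 ∧ W.LFunction 13 = -4 ∧ W.LFunction 19 = 2) := by
  obtain ⟨h11, h35, h49, h55⟩ := columnRelations_oneHundredEight D.f
  simp only [cuspCoeff_f108 D] at h11 h35 h49 h55
  exact coeffVector_oneHundredEight W (by exact_mod_cast h11) (by exact_mod_cast h35) (by exact_mod_cast h49)
    (by exact_mod_cast h55)

omit [W.IsElliptic] in
/-- **An old form with the ten pivot coefficients of `D.f` contradicts newness** (`old ⊓ new = ⊥` and the pivots separate `S₂(Γ₀(108))`).
[cite: AtkinLehner1970, Thm. 5] -/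
theorem false_of_oldWitness_oneHundredEight (D : ModularParametrizationData W 108) (G : CuspForm (Gamma0 108) 2)
    (hG : G ∈ oldSubspace0 108 2)
    (g1 : cuspCoeff G 1 = (W.LFunction 1 : ℂ)) (g2 : cuspCoeff G 2 = (W.LFunction 2 : ℂ)) (g3 : cuspCoeff G 3 = (W.LFunction 3 : ℂ))
    (g4 : cuspCoeff G 4 = (W.LFunction 4 : ℂ)) (g5 : cuspCoeff G 5 = (W.LFunction 5 : ℂ)) (g7 : cuspCoeff G 7 = (W.LFunction 7 : ℂ))
    (g8 : cuspCoeff G 8 = (W.LFunction 8 : ℂ)) (g10 : cuspCoeff G 10 = (W.LFunction 10 : ℂ))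
    (g13 : cuspCoeff G 13 = (W.LFunction 13 : ℂ)) (g19 : cuspCoeff G 19 = (W.LFunction 19 : ℂ)) : False := by
  apply LevelFortyFour.not_mem_oldSubspace0_of_isNewform0 D.isNewformOf.1
  have hDG : D.f = G := pivotsSeparate_oneHundredEight D.f G (by rw [cuspCoeff_f108, g1]) (by rw [cuspCoeff_f108, g2])
    (by rw [cuspCoeff_f108, g3]) (by rw [cuspCoeff_f108, g4]) (by rw [cuspCoeff_f108, g5]) (by rw [cuspCoeff_f108, g7])
    (by rw [cuspCoeff_f108, g8]) (by rw [cuspCoeff_f108, g10]) (by rw [cuspCoeff_f108, g13]) (by rw [cuspCoeff_f108, g19])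
  rw [hDG]
  exact hG

/-- **`(a₅, a₇, a₁₃, a₁₉)(W) = (0, 5, −7, −1)` for every elliptic `W/ℚ` carrying an `X₀(108)`-datum** — FACT-FREE: the eight old cases die on
`oldWitness108_3 … oldWitness108_10`. [cite: AtkinLehner1970, Thm. 5] [cite: CremonaAlgorithms1997, Table 3 (N = 108)] -/
theorem coeffs_eq_oneHundredEightA (D : ModularParametrizationData W 108) :
    W.LFunction 5 = 0 ∧ W.LFunction 7 = 5 ∧ W.LFunction 13 = -7 ∧ W.LFunction 19 = -1 := by
  obtain ⟨h2, h3, -, -⟩ := curveInputs_oneHundredEight D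
  obtain ⟨h4, h8, h10⟩ := deadPivots_oneHundredEight D
  have hL1 : W.LFunction 1 = 1 := W.LFunction_apply_one
  rcases coeffs_cases_oneHundredEight D with h | ⟨h5, h7, h13, h19⟩ | ⟨h5, h7, h13, h19⟩ | ⟨h5, h7, h13, h19⟩ |
      ⟨h5, h7, h13, h19⟩ | ⟨h5, h7, h13, h19⟩ | ⟨h5, h7, h13, h19⟩ | ⟨h5, h7, h13, h19⟩ | ⟨h5, h7, h13, h19⟩
  · exact h
  · exfalso
    obtain ⟨G, hG, g1, g2, g3, g4, g5, g7, g8, g10, g13, g19⟩ := oldWitness108_7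
    exact false_of_oldWitness_oneHundredEight D G hG (by rw [g1, hL1]; norm_num) (by rw [g2, h2]; norm_num)
      (by rw [g3, h3]; norm_num) (by rw [g4, h4]; norm_num) (by rw [g5, h5]; norm_num) (by rw [g7, h7]; norm_num)
      (by rw [g8, h8]; norm_num) (by rw [g10, h10]; norm_num) (by rw [g13, h13]; norm_num) (by rw [g19, h19]; norm_num)
  · exfalso
    obtain ⟨G, hG, g1, g2, g3, g4, g5, g7, g8, g10, g13, g19⟩ := oldWitness108_6
    exact false_of_oldWitness_oneHundredEight D G hG (by rw [g1, hL1]; norm_num) (by rw [g2, h2]; norm_num)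
      (by rw [g3, h3]; norm_num) (by rw [g4, h4]; norm_num) (by rw [g5, h5]; norm_num) (by rw [g7, h7]; norm_num)
      (by rw [g8, h8]; norm_num) (by rw [g10, h10]; norm_num) (by rw [g13, h13]; norm_num) (by rw [g19, h19]; norm_num)
  · exfalso
    obtain ⟨G, hG, g1, g2, g3, g4, g5, g7, g8, g10, g13, g19⟩ := oldWitness108_8
    exact false_of_oldWitness_oneHundredEight D G hG (by rw [g1, hL1]; norm_num) (by rw [g2, h2]; norm_num)
      (by rw [g3, h3]; norm_num) (by rw [g4, h4]; norm_num) (by rw [g5, h5]; norm_num) (by rw [g7, h7]; norm_num)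
      (by rw [g8, h8]; norm_num) (by rw [g10, h10]; norm_num) (by rw [g13, h13]; norm_num) (by rw [g19, h19]; norm_num)
  · exfalso
    obtain ⟨G, hG, g1, g2, g3, g4, g5, g7, g8, g10, g13, g19⟩ := oldWitness108_5
    exact false_of_oldWitness_oneHundredEight D G hG (by rw [g1, hL1]; norm_num) (by rw [g2, h2]; norm_num)
      (by rw [g3, h3]; norm_num) (by rw [g4, h4]; norm_num) (by rw [g5, h5]; norm_num) (by rw [g7, h7]; norm_num)
      (by rw [g8, h8]; norm_num) (by rw [g10, h10]; norm_num) (by rw [g13, h13]; norm_num) (by rw [g19, h19]; norm_num)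
  · exfalso
    obtain ⟨G, hG, g1, g2, g3, g4, g5, g7, g8, g10, g13, g19⟩ := oldWitness108_9
    exact false_of_oldWitness_oneHundredEight D G hG (by rw [g1, hL1]; norm_num) (by rw [g2, h2]; norm_num)
      (by rw [g3, h3]; norm_num) (by rw [g4, h4]; norm_num) (by rw [g5, h5]; norm_num) (by rw [g7, h7]; norm_num)
      (by rw [g8, h8]; norm_num) (by rw [g10, h10]; norm_num) (by rw [g13, h13]; norm_num) (by rw [g19, h19]; norm_num)
  · exfalso
    obtain ⟨G, hG, g1, g2, g3, g4, g5, g7, g8, g10, g13, g19⟩ := oldWitness108_4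
    exact false_of_oldWitness_oneHundredEight D G hG (by rw [g1, hL1]; norm_num) (by rw [g2, h2]; norm_num)
      (by rw [g3, h3]; norm_num) (by rw [g4, h4]; norm_num) (by rw [g5, h5]; norm_num) (by rw [g7, h7]; norm_num)
      (by rw [g8, h8]; norm_num) (by rw [g10, h10]; norm_num) (by rw [g13, h13]; norm_num) (by rw [g19, h19]; norm_num)
  · exfalso
    obtain ⟨G, hG, g1, g2, g3, g4, g5, g7, g8, g10, g13, g19⟩ := oldWitness108_10
    exact false_of_oldWitness_oneHundredEight D G hG (by rw [g1, hL1]; norm_num) (by rw [g2, h2]; norm_num)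
      (by rw [g3, h3]; norm_num) (by rw [g4, h4]; norm_num) (by rw [g5, h5]; norm_num) (by rw [g7, h7]; norm_num)
      (by rw [g8, h8]; norm_num) (by rw [g10, h10]; norm_num) (by rw [g13, h13]; norm_num) (by rw [g19, h19]; norm_num)
  · exfalso
    obtain ⟨G, hG, g1, g2, g3, g4, g5, g7, g8, g10, g13, g19⟩ := oldWitness108_3
    exact false_of_oldWitness_oneHundredEight D G hG (by rw [g1, hL1]; norm_num) (by rw [g2, h2]; norm_num)
      (by rw [g3, h3]; norm_num) (by rw [g4, h4]; norm_num) (by rw [g5, h5]; norm_num) (by rw [g7, h7]; norm_num)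
      (by rw [g8, h8]; norm_num) (by rw [g10, h10]; norm_num) (by rw [g13, h13]; norm_num) (by rw [g19, h19]; norm_num)

/-! ## §3 The pinning -/

/-- **`D.f = −2B₁c + 2B₂c + B₃c + 6B₄c + 6B₅c`** on the ten-form basis (coordinates `(−2, 2, 1, 6, 6, 0, 0, 0, 0, 0)`), for every
`X₀(108)`-datum `D` of every elliptic `W/ℚ` — FACT-FREE. [cite: CremonaAlgorithms1997, Table 3 (N = 108)] -/
theorem f_eq_phi108 (D : ModularParametrizationData W 108) :
    D.f = ∑ i, (![(-2 : ℂ), 2, 1, 6, 6, 0, 0, 0, 0, 0] : Fin 10 → ℂ) i • basis108 i := by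
  obtain ⟨h5, h7, h13, h19⟩ := coeffs_eq_oneHundredEightA D
  obtain ⟨h2, h3, -, -⟩ := curveInputs_oneHundredEight D
  obtain ⟨h4, h8, h10⟩ := deadPivots_oneHundredEight D
  have hL1 : W.LFunction 1 = 1 := W.LFunction_apply_one
  obtain ⟨e0_1, e0_2, e0_3, e0_4, e0_5, e0_7, e0_8, e0_10, e0_13, e0_19⟩ := cols_B1c
  obtain ⟨e1_1, e1_2, e1_3, e1_4, e1_5, e1_7, e1_8, e1_10, e1_13, e1_19⟩ := cols_B2c
  obtain ⟨e2_1, e2_2, e2_3, e2_4, e2_5, e2_7, e2_8, e2_10, e2_13, e2_19⟩ := cols_B3c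
  obtain ⟨e3_1, e3_2, e3_3, e3_4, e3_5, e3_7, e3_8, e3_10, e3_13, e3_19⟩ := cols_B4c
  obtain ⟨e4_1, e4_2, e4_3, e4_4, e4_5, e4_7, e4_8, e4_10, e4_13, e4_19⟩ := cols_B5c
  refine pivotsSeparate_oneHundredEight _ _ ?_ ?_ ?_ ?_ ?_ ?_ ?_ ?_ ?_ ?_ <;>
    rw [cuspCoeff_f108, cuspCoeff_sum_smul108] <;>
    simp only [Fin.sum_univ_succ, Fin.sum_univ_zero, basis108, Matrix.cons_val_zero, Matrix.cons_val_succ,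
      e0_1, e0_2, e0_3, e0_4, e0_5, e0_7, e0_8, e0_10, e0_13, e0_19, e1_1, e1_2, e1_3, e1_4, e1_5, e1_7, e1_8, e1_10, e1_13, e1_19,
      e2_1, e2_2, e2_3, e2_4, e2_5, e2_7, e2_8, e2_10, e2_13, e2_19, e3_1, e3_2, e3_3, e3_4, e3_5, e3_7, e3_8, e3_10, e3_13, e3_19,
      e4_1, e4_2, e4_3, e4_4, e4_5, e4_7, e4_8, e4_10, e4_13, e4_19, hL1, h2, h3, h4, h5, h7, h8, h10, h13, h19] <;>
    norm_num

/-- **THE NEWFORM OF EVERY `X₀(108)`-DATUM IS `φ₁₀₈`, AS A FUNCTION ON `ℍ`** — literally the hypothesis `hpin` of p3 g24's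
`NeronSqueezeOneHundredEight.maninConstant_oneHundredEight_of_pinning` (the five `η`-quotients `B₁, …, B₅` of `…EtaBasisOneHundredEight`
spelled out by their exponent vectors) — FACT-FREE. [cite: CremonaAlgorithms1997, Table 3 (N = 108)] [cite: Koehler2011, §2.1] -/
theorem f_apply_eq_phi108 (D : ModularParametrizationData W 108) :
    ⇑D.f = fun τ ↦ (-2 * etaQuotient 108 (expFn [(6, 1), (18, 2), (36, -2), (54, -3), (108, 6)]) τ + 2 * etaQuotient 108 (expFn [(6, 1), (9, 1), (18, -1), (27, -3), (54, 6)]) τ + etaQuotient 108 (expFn [(6, 1), (9, 2), (18, -4), (27, -6), (36, 2), (54, 15), (108, -6)]) τ + 6 * etaQuotient 108 (expFn [(6, 2), (12, -2), (18, -2), (36, 6)]) τ + 6 * etaQuotient 108 (expFn [(6, 1), (18, 1), (36, -1), (108, 3)]) τ) := by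
  rw [f_eq_phi108 D]
  simp only [Fin.sum_univ_succ, Fin.sum_univ_zero, basis108, Matrix.cons_val_zero, Matrix.cons_val_succ, zero_smul, add_zero,
    one_smul]
  funext τ
  simp only [CuspForm.coe_add, Pi.add_apply, CuspForm.IsGLPos.smul_apply, smul_eq_mul, coe_B1c, coe_B2c, coe_B3c, coe_B4c,
    coe_B5c, B1, B2, B3, B4, B5, coe_etaQuotientModularForm, rB1, rB2, rB3, rB4, rB5]
  ring

end Summit.BirchSwinnertonDyer.BirchSwinnertonDyer.Theorems.ManinLocalTwoThree.LevelOneHundredEight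

end
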